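import Summits.HodgeConjecture.CorCM.IrreducibleOddWeightsMultiClassRank
import Summits.HodgeConjecture.CorCM.IrreducibleOddWeightsSubfamilyDominationCMFields
import HarnessLib

/-!
# The multiplicity formula across all isotypic classes, V-CM: PRODUCTS OF CM ABELIAN VARIETIES —
# `dim MT(∏_i A_i) = Σ_c r_c·dim A_c + 1`, `Hg(∏_i A_i) = ∏_i Hg(A_i) ⟺ ∀ c` the `D_c⟨b^i_c⟩` are independent,
# `dim MT(∏_I A_i) = dim MT(∏_T A_i) ⟺ ∀ c ∀ i, D_c⟨b^i_c⟩ ≤ ⨆_{j∈T} D_c⟨b^j_c⟩`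

COR-CM (cell `pub-hodgecm2`, binder seat `b16` gen 75, count-neutral claim THE MULTIPLICITY FORMULA ACROSS ALL
ISOTYPIC CLASSES FOR A WHOLE FAMILY, file M5-CM — the CM dress of file M5 `…MultiClassRank` (`G = Aut(ℂ)`, slots
`Hom(K_i, ℂ)`, sub-families `T ⊆ I` as `Finset`s); theorems only, no definition, no named fact, no `sorry`).  NEW as
stated, hence under `Summits/`.  HONEST FRAMING: statements about `cmFamilyRank Φ = dim MT(∏_i A_i)` and
`cmTypeRank Φ_i = dim MT(A_i)` (tree) for CM fields `K_i` and CM types `Φ_i` whose type vectors are decomposed over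
pairwise non-isomorphic reference `Aut(ℂ)`-stable irreducibles `A_c ≤ ℚ^{Y_c}` (`A_c ≠ 0`, commutant `𝒟_c` ANY):
`u_i = Σ_c Σ_j ι^i_{c,j}(b^i_{c,j})` — the census side supplies this isotypic decomposition.  Gen 74 S4-CM
(`…SubfamilyDominationCMFields` §2) is the case of ONE class.  Nothing is claimed about the algebraicity of Hodge
classes; `HC_CM` is neither used nor asserted.

* **`cmFamilyRank_eq_sum_of_classes`**: `∃ r_c ≤ Σ_i |J_{i,c}|`, `dim ⨆_{i,j} D_c·b^i_{c,j} = r_c·δ_c`,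
  **`dim MT(∏_i A_i) = Σ_c r_c·dim A_c + 1`**; one factor **`cmTypeRank_eq_sum_of_classes`**
  (`dim MT(A_i) = Σ_c r^i_c·dim A_c + 1`).
* **`cmFamilyRank_add_card_eq_iff_forall_iSupIndep_of_classes`**: `Hg(∏_i A_i) = ∏_i Hg(A_i) ⟺ ∀ c`, the D-spans
  `D_c⟨b^i_c⟩` (`i ∈ I`) are INDEPENDENT in `A_c`.
* **`cmFamilyRank_eq_restrict_iff_forall_iSup_le_of_classes`** (`T ≠ ∅`): `dim MT(∏_I A_i) = dim MT(∏_T A_i) ⟺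
  ∀ c ∀ i, D_c⟨b^i_c⟩ ≤ ⨆_{j∈T} D_c⟨b^j_c⟩`; the last factor `cmFamilyRank_eq_erase_iff_forall_iSup_le_of_classes`.

## References

* [Deligne1982HodgeCycles] P. Deligne, *Hodge cycles on abelian varieties*, LNM 900 (1982), I.5 (p. 53), I Ex. 3.7.
* [Gordon1999HodgeAVSurvey] B. B. Gordon, *A survey of the Hodge conjecture for abelian varieties*, §3 Theorem (Imai,
  Murty) with proof, 7.5–7.7, 9.4.3.
* [Lang2002] S. Lang, *Algebra*, 3rd ed., XVII §1 and §3.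
* [Serre1977] J.-P. Serre, *Linear Representations of Finite Groups*, GTM 42, §2.6.
-/

set_option autoImplicit false

noncomputable section

open scoped BigOperators Classical

namespace Summit.HodgeConjecture.CorCM

open CategoryTheory CategoryTheory.Limits NumberField Module IntermediateField
open Literature.NumberTheory.ComplexMultiplication
open Literature.AlgebraicGeometry.Motives (AbelianVariety CMType)
open Literature.AlgebraicGeometry.Motives.AbelianVariety
open Literature.AlgebraicGeometry.HodgeTheory
open Literature.AlgebraicGeometry.ComplexMultiplication (IsCMTypeRealisation)
open Literature.AlgebraicGeometry.Pohlmann1968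

variable {I : Type} [Fintype I] {K : I → Type} [∀ i, Field (K i)] [∀ i, NumberField (K i)] [∀ i, IsCMField (K i)]
  {C : Type} [Fintype C] {Yc : C → Type} [∀ c, MulAction (ℂ ≃+* ℂ) (Yc c)] [∀ c, Fintype (Yc c)]
  {Ar : ∀ c, Submodule ℚ (Yc c → ℚ)} {𝒟 : ∀ c, Submodule ℚ ((Yc c → ℚ) →ₗ[ℚ] (Yc c → ℚ))}
  {JJ : I → C → Type} [∀ i c, Fintype (JJ i c)]

/-- **`dim MT(∏_i A_i) = Σ_c r_c·dim A_c + 1` ACROSS ALL ISOTYPIC CLASSES** (`r_c ≤ Σ_i |J_{i,c}|` the `D_c`-rank of all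
class-`c` components of all type vectors, `dim ⨆_{i,j} D_c·b^i_{c,j} = r_c·δ_c`): **`dim Hg(∏_i A_i) = Σ_c r_c·dim A_c`**.
[cite: Deligne1982HodgeCycles, I.5 (p. 53) and I Ex. 3.7 (c)] [cite: Lang2002, XVII §3] -/
theorem cmFamilyRank_eq_sum_of_classes [Nonempty I] (Φ : ∀ i, CMType (K i))
    (h𝒟 : ∀ c (L : (Yc c → ℚ) →ₗ[ℚ] (Yc c → ℚ)), L ∈ 𝒟 c ↔ (∀ a ∈ Ar c, L a ∈ Ar c) ∧
      ∀ (k : ℂ ≃+* ℂ) (a : Yc c → ℚ), a ∈ Ar c → L (fun y => a (k • y)) = fun y => L a (k • y))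
    (hRst : ∀ c (k : ℂ ≃+* ℂ) (a : Yc c → ℚ), a ∈ Ar c → (fun y => a (k • y)) ∈ Ar c)
    (hRirr : ∀ c (W : Submodule ℚ (Yc c → ℚ)), W ≤ Ar c → W ≠ ⊥ →
      (∀ (k : ℂ ≃+* ℂ) (f : Yc c → ℚ), f ∈ W → (fun y => f (k • y)) ∈ W) → W = Ar c)
    (hsep : ∀ c c' (L : (Yc c → ℚ) →ₗ[ℚ] (Yc c' → ℚ)), c ≠ c' → Ar c ≠ ⊥ → (∀ a ∈ Ar c, L a ∈ Ar c') →
      (∀ a ∈ Ar c, L a = 0 → a = 0) →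
      (∀ (k : ℂ ≃+* ℂ) (a : Yc c → ℚ), a ∈ Ar c → L (fun y => a (k • y)) = fun y => L a (k • y)) → False)
    (ι : ∀ i c, JJ i c → ((Yc c → ℚ) →ₗ[ℚ] ((K i →+* ℂ) → ℚ)))
    (hιeq : ∀ i c (j : JJ i c) (k : ℂ ≃+* ℂ) (a : Yc c → ℚ), a ∈ Ar c →
      ι i c j (fun y => a (k • y)) = fun y => ι i c j a (k • y))
    (hind : ∀ i c (f : JJ i c → (Yc c → ℚ)), (∀ j, f j ∈ Ar c) → ∑ j, ι i c j (f j) = 0 → ∀ j, f j = 0)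
    {b : ∀ i c, JJ i c → (Yc c → ℚ)} (hb : ∀ i c j, b i c j ∈ Ar c)
    (hu : ∀ i, antiVec (Φ i).1 (1 : ℂ ≃+* ℂ) = ∑ c, ∑ j, ι i c j (b i c j))
    {a₀ : ∀ c, Yc c → ℚ} (ha₀ : ∀ c, a₀ c ∈ Ar c) (h0 : ∀ c, a₀ c ≠ 0) :
    ∃ r : C → ℕ, (∀ c, r c ≤ ∑ i, Fintype.card (JJ i c)) ∧
      (∀ c, Module.finrank ℚ ↥(⨆ i, ⨆ j, (𝒟 c).map (LinearMap.applyₗ (b i c j))) =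
        r c * Module.finrank ℚ ↥((𝒟 c).map (LinearMap.applyₗ (a₀ c)))) ∧
      CMAlgebra.cmFamilyRank Φ = (∑ c, r c * Module.finrank ℚ (Ar c)) + 1 := by
  haveI : ∀ i, Nonempty (K i →+* ℂ) := fun i => inferInstance
  exact IrrOdd.exists_rank_typeRank_sigmaType_eq_sum_of_classes (G := ℂ ≃+* ℂ) (E := fun i => K i →+* ℂ)
    (Φ := fun i => (Φ i).1) (fun i => isCMTypeWith_conj (Φ i)) h𝒟 hRst hRirr hsep ι hιeq hind hb hu ha₀ h0

omit [Fintype I] in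
/-- **ONE FACTOR: `dim MT(A_i) = Σ_c r^i_c·dim A_c + 1`** (`dim D_c⟨b^i_c⟩ = r^i_c·δ_c`, `r^i_c ≤ |J_{i,c}|`).
[cite: Deligne1982HodgeCycles, I.3.4] [cite: Lang2002, XVII §3] -/
theorem cmTypeRank_eq_sum_of_classes (Φ : ∀ i, CMType (K i)) (i₀ : I)
    (h𝒟 : ∀ c (L : (Yc c → ℚ) →ₗ[ℚ] (Yc c → ℚ)), L ∈ 𝒟 c ↔ (∀ a ∈ Ar c, L a ∈ Ar c) ∧
      ∀ (k : ℂ ≃+* ℂ) (a : Yc c → ℚ), a ∈ Ar c → L (fun y => a (k • y)) = fun y => L a (k • y))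
    (hRst : ∀ c (k : ℂ ≃+* ℂ) (a : Yc c → ℚ), a ∈ Ar c → (fun y => a (k • y)) ∈ Ar c)
    (hRirr : ∀ c (W : Submodule ℚ (Yc c → ℚ)), W ≤ Ar c → W ≠ ⊥ →
      (∀ (k : ℂ ≃+* ℂ) (f : Yc c → ℚ), f ∈ W → (fun y => f (k • y)) ∈ W) → W = Ar c)
    (hsep : ∀ c c' (L : (Yc c → ℚ) →ₗ[ℚ] (Yc c' → ℚ)), c ≠ c' → Ar c ≠ ⊥ → (∀ a ∈ Ar c, L a ∈ Ar c') →
      (∀ a ∈ Ar c, L a = 0 → a = 0) →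
      (∀ (k : ℂ ≃+* ℂ) (a : Yc c → ℚ), a ∈ Ar c → L (fun y => a (k • y)) = fun y => L a (k • y)) → False)
    (ι : ∀ i c, JJ i c → ((Yc c → ℚ) →ₗ[ℚ] ((K i →+* ℂ) → ℚ)))
    (hιeq : ∀ i c (j : JJ i c) (k : ℂ ≃+* ℂ) (a : Yc c → ℚ), a ∈ Ar c →
      ι i c j (fun y => a (k • y)) = fun y => ι i c j a (k • y))
    (hind : ∀ i c (f : JJ i c → (Yc c → ℚ)), (∀ j, f j ∈ Ar c) → ∑ j, ι i c j (f j) = 0 → ∀ j, f j = 0)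
    {b : ∀ i c, JJ i c → (Yc c → ℚ)} (hb : ∀ i c j, b i c j ∈ Ar c)
    (hu : ∀ i, antiVec (Φ i).1 (1 : ℂ ≃+* ℂ) = ∑ c, ∑ j, ι i c j (b i c j))
    {a₀ : ∀ c, Yc c → ℚ} (ha₀ : ∀ c, a₀ c ∈ Ar c) (h0 : ∀ c, a₀ c ≠ 0) :
    ∃ r : C → ℕ, (∀ c, r c ≤ Fintype.card (JJ i₀ c)) ∧
      (∀ c, Module.finrank ℚ ↥(⨆ j, (𝒟 c).map (LinearMap.applyₗ (b i₀ c j))) =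
        r c * Module.finrank ℚ ↥((𝒟 c).map (LinearMap.applyₗ (a₀ c)))) ∧
      cmTypeRank (Φ i₀) = (∑ c, r c * Module.finrank ℚ (Ar c)) + 1 := by
  haveI : ∀ i, Nonempty (K i →+* ℂ) := fun i => inferInstance
  exact IrrOdd.exists_rank_typeRank_eq_sum_of_classes (G := ℂ ≃+* ℂ) (E := fun i => K i →+* ℂ)
    (Φ := fun i => (Φ i).1) (fun i => isCMTypeWith_conj (Φ i)) i₀ h𝒟 hRst hRirr hsep ι hιeq hind hb hu ha₀ h0

/-- **ADDITIVITY ACROSS ALL ISOTYPIC CLASSES (CM fields): `Hg(∏_i A_i) = ∏_i Hg(A_i)` (`cmFamilyRank Φ + |I| =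
Σ_i cmTypeRank Φ_i + 1`) IFF for every class `c` the D-spans `D_c⟨b^i_c⟩ ≤ A_c` (`i ∈ I`) are INDEPENDENT.**
[cite: Gordon1999HodgeAVSurvey, §3 Theorem and 7.5–7.7] [cite: Deligne1982HodgeCycles, I.5 (p. 53)]
[cite: Lang2002, XVII §1 and §3] -/
theorem cmFamilyRank_add_card_eq_iff_forall_iSupIndep_of_classes [Nonempty I] (Φ : ∀ i, CMType (K i))
    (h𝒟 : ∀ c (L : (Yc c → ℚ) →ₗ[ℚ] (Yc c → ℚ)), L ∈ 𝒟 c ↔ (∀ a ∈ Ar c, L a ∈ Ar c) ∧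
      ∀ (k : ℂ ≃+* ℂ) (a : Yc c → ℚ), a ∈ Ar c → L (fun y => a (k • y)) = fun y => L a (k • y))
    (hRst : ∀ c (k : ℂ ≃+* ℂ) (a : Yc c → ℚ), a ∈ Ar c → (fun y => a (k • y)) ∈ Ar c)
    (hRirr : ∀ c (W : Submodule ℚ (Yc c → ℚ)), W ≤ Ar c → W ≠ ⊥ →
      (∀ (k : ℂ ≃+* ℂ) (f : Yc c → ℚ), f ∈ W → (fun y => f (k • y)) ∈ W) → W = Ar c)
    (hR0 : ∀ c, Ar c ≠ ⊥)
    (hsep : ∀ c c' (L : (Yc c → ℚ) →ₗ[ℚ] (Yc c' → ℚ)), c ≠ c' → Ar c ≠ ⊥ → (∀ a ∈ Ar c, L a ∈ Ar c') →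
      (∀ a ∈ Ar c, L a = 0 → a = 0) →
      (∀ (k : ℂ ≃+* ℂ) (a : Yc c → ℚ), a ∈ Ar c → L (fun y => a (k • y)) = fun y => L a (k • y)) → False)
    (ι : ∀ i c, JJ i c → ((Yc c → ℚ) →ₗ[ℚ] ((K i →+* ℂ) → ℚ)))
    (hιeq : ∀ i c (j : JJ i c) (k : ℂ ≃+* ℂ) (a : Yc c → ℚ), a ∈ Ar c →
      ι i c j (fun y => a (k • y)) = fun y => ι i c j a (k • y))
    (hind : ∀ i c (f : JJ i c → (Yc c → ℚ)), (∀ j, f j ∈ Ar c) → ∑ j, ι i c j (f j) = 0 → ∀ j, f j = 0)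
    {b : ∀ i c, JJ i c → (Yc c → ℚ)} (hb : ∀ i c j, b i c j ∈ Ar c)
    (hu : ∀ i, antiVec (Φ i).1 (1 : ℂ ≃+* ℂ) = ∑ c, ∑ j, ι i c j (b i c j)) :
    CMAlgebra.cmFamilyRank Φ + Fintype.card I = (∑ i, cmTypeRank (Φ i)) + 1 ↔
      ∀ c, iSupIndep fun i => ⨆ j, (𝒟 c).map (LinearMap.applyₗ (b i c j)) := by
  haveI : ∀ i, Nonempty (K i →+* ℂ) := fun i => inferInstance
  exact IrrOdd.typeRank_sigmaType_add_card_eq_iff_forall_iSupIndep_of_classes (G := ℂ ≃+* ℂ)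
    (E := fun i => K i →+* ℂ) (Φ := fun i => (Φ i).1) (fun i => isCMTypeWith_conj (Φ i)) h𝒟 hRst hRirr hR0 hsep
    ι hιeq hind hb hu

/-- **SUB-PRODUCT DOMINATION ACROSS ALL ISOTYPIC CLASSES (CM fields): `dim MT(∏_I A_i) = dim MT(∏_T A_i) ⟺ ∀ c ∀ i,
D_c⟨b^i_c⟩ ≤ ⨆_{j∈T} D_c⟨b^j_c⟩`** (`T ≠ ∅`): every factor is Hodge-dominated by the sub-product `∏_T A_j` iff, class
by class, its type components are `D_c`-combinations of those of the factors in `T`. [cite: Deligne1982HodgeCycles,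
I.5 (p. 53)] [cite: Gordon1999HodgeAVSurvey, §3 Theorem (proof), 7.5–7.7 and 9.4.3] [cite: Lang2002, XVII §3] -/
theorem cmFamilyRank_eq_restrict_iff_forall_iSup_le_of_classes (Φ : ∀ i, CMType (K i)) (T : Finset I)
    (hT : T.Nonempty)
    (h𝒟 : ∀ c (L : (Yc c → ℚ) →ₗ[ℚ] (Yc c → ℚ)), L ∈ 𝒟 c ↔ (∀ a ∈ Ar c, L a ∈ Ar c) ∧
      ∀ (k : ℂ ≃+* ℂ) (a : Yc c → ℚ), a ∈ Ar c → L (fun y => a (k • y)) = fun y => L a (k • y))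
    (hRst : ∀ c (k : ℂ ≃+* ℂ) (a : Yc c → ℚ), a ∈ Ar c → (fun y => a (k • y)) ∈ Ar c)
    (hRirr : ∀ c (W : Submodule ℚ (Yc c → ℚ)), W ≤ Ar c → W ≠ ⊥ →
      (∀ (k : ℂ ≃+* ℂ) (f : Yc c → ℚ), f ∈ W → (fun y => f (k • y)) ∈ W) → W = Ar c)
    (hR0 : ∀ c, Ar c ≠ ⊥)
    (hsep : ∀ c c' (L : (Yc c → ℚ) →ₗ[ℚ] (Yc c' → ℚ)), c ≠ c' → Ar c ≠ ⊥ → (∀ a ∈ Ar c, L a ∈ Ar c') →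
      (∀ a ∈ Ar c, L a = 0 → a = 0) →
      (∀ (k : ℂ ≃+* ℂ) (a : Yc c → ℚ), a ∈ Ar c → L (fun y => a (k • y)) = fun y => L a (k • y)) → False)
    (ι : ∀ i c, JJ i c → ((Yc c → ℚ) →ₗ[ℚ] ((K i →+* ℂ) → ℚ)))
    (hιeq : ∀ i c (j : JJ i c) (k : ℂ ≃+* ℂ) (a : Yc c → ℚ), a ∈ Ar c →
      ι i c j (fun y => a (k • y)) = fun y => ι i c j a (k • y))
    (hind : ∀ i c (f : JJ i c → (Yc c → ℚ)), (∀ j, f j ∈ Ar c) → ∑ j, ι i c j (f j) = 0 → ∀ j, f j = 0)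
    {b : ∀ i c, JJ i c → (Yc c → ℚ)} (hb : ∀ i c j, b i c j ∈ Ar c)
    (hu : ∀ i, antiVec (Φ i).1 (1 : ℂ ≃+* ℂ) = ∑ c, ∑ j, ι i c j (b i c j)) :
    CMAlgebra.cmFamilyRank Φ = CMAlgebra.cmFamilyRank (fun j : T => Φ j.1) ↔
      ∀ c i, (⨆ j, (𝒟 c).map (LinearMap.applyₗ (b i c j))) ≤
        ⨆ j' : T, ⨆ j, (𝒟 c).map (LinearMap.applyₗ (b j'.1 c j)) := by
  haveI : Nonempty {j // j ∈ T} := hT.coe_sort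
  haveI : ∀ i, Nonempty (K i →+* ℂ) := fun i => inferInstance
  exact IrrOdd.typeRank_sigmaType_eq_reindex_iff_forall_iSup_le_of_classes (G := ℂ ≃+* ℂ)
    (E := fun i => K i →+* ℂ) (Φ := fun i => (Φ i).1) (fun i => isCMTypeWith_conj (Φ i))
    (Subtype.val : {j // j ∈ T} → I) h𝒟 hRst hRirr hR0 hsep ι hιeq hind hb hu

/-- **THE LAST FACTOR ACROSS ALL ISOTYPIC CLASSES (CM fields): `dim MT(∏_I A_i) = dim MT(∏_{i≠i₀} A_i) ⟺ ∀ c,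
D_c⟨b^{i₀}_c⟩ ≤ ⨆_{i≠i₀} D_c⟨b^i_c⟩`** (`|I| ≥ 2`): `A_{i₀}` is Hodge-dominated by the product of the others iff in
every class its components are `D_c`-combinations of theirs. [cite: Deligne1982HodgeCycles, I.5 (p. 53)]
[cite: Gordon1999HodgeAVSurvey, §3 Theorem (proof), 7.5–7.7] [cite: Lang2002, XVII §3] -/
theorem cmFamilyRank_eq_erase_iff_forall_iSup_le_of_classes [Nontrivial I] (Φ : ∀ i, CMType (K i)) (i₀ : I)
    (h𝒟 : ∀ c (L : (Yc c → ℚ) →ₗ[ℚ] (Yc c → ℚ)), L ∈ 𝒟 c ↔ (∀ a ∈ Ar c, L a ∈ Ar c) ∧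
      ∀ (k : ℂ ≃+* ℂ) (a : Yc c → ℚ), a ∈ Ar c → L (fun y => a (k • y)) = fun y => L a (k • y))
    (hRst : ∀ c (k : ℂ ≃+* ℂ) (a : Yc c → ℚ), a ∈ Ar c → (fun y => a (k • y)) ∈ Ar c)
    (hRirr : ∀ c (W : Submodule ℚ (Yc c → ℚ)), W ≤ Ar c → W ≠ ⊥ →
      (∀ (k : ℂ ≃+* ℂ) (f : Yc c → ℚ), f ∈ W → (fun y => f (k • y)) ∈ W) → W = Ar c)
    (hR0 : ∀ c, Ar c ≠ ⊥)
    (hsep : ∀ c c' (L : (Yc c → ℚ) →ₗ[ℚ] (Yc c' → ℚ)), c ≠ c' → Ar c ≠ ⊥ → (∀ a ∈ Ar c, L a ∈ Ar c') →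
      (∀ a ∈ Ar c, L a = 0 → a = 0) →
      (∀ (k : ℂ ≃+* ℂ) (a : Yc c → ℚ), a ∈ Ar c → L (fun y => a (k • y)) = fun y => L a (k • y)) → False)
    (ι : ∀ i c, JJ i c → ((Yc c → ℚ) →ₗ[ℚ] ((K i →+* ℂ) → ℚ)))
    (hιeq : ∀ i c (j : JJ i c) (k : ℂ ≃+* ℂ) (a : Yc c → ℚ), a ∈ Ar c →
      ι i c j (fun y => a (k • y)) = fun y => ι i c j a (k • y))
    (hind : ∀ i c (f : JJ i c → (Yc c → ℚ)), (∀ j, f j ∈ Ar c) → ∑ j, ι i c j (f j) = 0 → ∀ j, f j = 0)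
    {b : ∀ i c, JJ i c → (Yc c → ℚ)} (hb : ∀ i c j, b i c j ∈ Ar c)
    (hu : ∀ i, antiVec (Φ i).1 (1 : ℂ ≃+* ℂ) = ∑ c, ∑ j, ι i c j (b i c j)) :
    CMAlgebra.cmFamilyRank Φ = CMAlgebra.cmFamilyRank (fun j : {j // j ≠ i₀} => Φ j.1) ↔
      ∀ c, (⨆ j, (𝒟 c).map (LinearMap.applyₗ (b i₀ c j))) ≤
        ⨆ i : {j // j ≠ i₀}, ⨆ j, (𝒟 c).map (LinearMap.applyₗ (b i.1 c j)) := by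
  obtain ⟨j₁, hj₁⟩ := exists_ne i₀
  haveI : Nonempty {j // j ≠ i₀} := ⟨⟨j₁, hj₁⟩⟩
  haveI : ∀ i, Nonempty (K i →+* ℂ) := fun i => inferInstance
  exact IrrOdd.typeRank_sigmaType_eq_iff_forall_iSup_le_of_erase_of_classes (G := ℂ ≃+* ℂ)
    (E := fun i => K i →+* ℂ) (Φ := fun i => (Φ i).1) (fun i => isCMTypeWith_conj (Φ i)) i₀ h𝒟 hRst hRirr hR0
    hsep ι hιeq hind hb hu

end Summit.HodgeConjecture.CorCM

end
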